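import Literature.Computability.Complexity.StackBricks
import Literature.Computability.Complexity.StackLists
import Literature.Computability.Complexity.StackUnaryBits
import Literature.Computability.Complexity.StackRoutines
import HarnessLib

/-!
# Item bricks: reading a counted number of items off a coded list, as an `FP` function

Trunk `CplxCore`, continuing `StackBricks.lean` (`Brick.binOp_mem_FP`). The replay machine of an
oracle algorithm consumes recorded answers one block at a time: given a width (a string `u`,
read as the count `|u|`) and the coded list of remaining answers `a` (`encList`, nested pairs),
it must either take `|u|` answers — here each answer is summarised by the bit "is it exactly
`[true]`", the format of the one-bit answers of a language oracle — and keep the rest, or report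
that fewer than `|u|` remain, together with how many (in binary, for the index of the pending
query). The list code is `encList` (nested `boolPair`, as in `StackBricksLists.lean`, whose
`rpStep`/`decItems` is the sibling total decoder — not the `encItems` coding of
`StackItemLists.lean`). This file provides that as one total brick:

* `Brick.obStep`, `Brick.obRun k a` — the model: `k` reading steps (`boolUnpair` while
  `wellPaired`), collecting the bits, counting, latching when the list runs out;
  `obRun_encList_of_le` / `obRun_encList_of_lt` — its value on a code `encList l`;
* `takeItemsFn ⟨u, a⟩ = ⟨[ok], ⟨payload, rest⟩⟩` with `ok = true`, `payload = norm bits`,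
  `rest` the unread string if `|u|` items were read, and `ok = false`, `payload = encodeNat count`
  otherwise (`takeItemsFn_encList_of_le`, `takeItemsFn_encList_of_lt`); **`takeItemsFn_mem_FP`**.

## References

* S. Arora, B. Barak, *Computational Complexity: A Modern Approach*, CUP 2009, §3.4 (oracle
  machines read the answers written so far), §0.1, §1.3.
* T. Nipkow, G. Klein, *Concrete Semantics with Isabelle/HOL*, Springer 2014, §7.2 (loop rule).
-/

namespace Literature.Computability.Complexity

open _root_.Computability AReg
open TokConv (incRes encodeNat_succ_eq_incRes length_incRes_le length_encodeNat_le)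

namespace Brick

-- `Sum.elim_update_left/right` loop against `Sum.update_elim_inl/inr` on register files.
attribute [-simp] Sum.elim_update_left Sum.elim_update_right

/-! ### The model -/

/-- State of the reader: unread string, bits read (in order), their number, the latch.
[folklore] -/
abbrev ObState := List Bool × List Bool × ℕ × Bool

/-- One reading step: latched stays; a well-formed pair yields the bit "item = [true]"; anything
else latches (and is discarded). [folklore] -/
def obStep (s : ObState) : ObState :=
  if s.2.2.2 then s
  else if wellPaired s.1 then ((boolUnpair s.1).2, s.2.1 ++ [decide ((boolUnpair s.1).1 = [true])], s.2.2.1 + 1, false)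
  else ([], s.2.1, s.2.2.1, true)

/-- `k` reading steps on `a`. [folklore] -/
def obRun (k : ℕ) (a : List Bool) : ObState := obStep^[k] (a, [], 0, false)

/-- Reading steps on a code, generalised over the bits and count so far. [folklore] -/
theorem obStep_iterate_encList : ∀ (k : ℕ) (l : List (List Bool)) (bs : List Bool) (c : ℕ),
    obStep^[k] (encList l, bs, c, false) =
      if k ≤ l.length then (encList (l.drop k), bs ++ (l.take k).map (fun it => decide (it = [true])), c + k, false)
      else ([], bs ++ l.map (fun it => decide (it = [true])), c + l.length, true)
  | 0, l, bs, c => by simp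
  | k + 1, [], bs, c => by
    rw [Function.iterate_succ_apply]
    have h1 : obStep (encList [], bs, c, false) = ([], bs, c, true) := by simp [obStep]
    rw [h1]
    have : obStep^[k] (([] : List Bool), bs, c, true) = ([], bs, c, true) := Function.iterate_fixed (by simp [obStep]) k
    rw [this]; simp
  | k + 1, it :: l, bs, c => by
    rw [Function.iterate_succ_apply]
    have h1 : obStep (encList (it :: l), bs, c, false) = (encList l, bs ++ [decide (it = [true])], c + 1, false) := by
      simp [obStep, wellPaired_encList, boolUnpair_encList_cons]
    rw [h1, obStep_iterate_encList k l]
    by_cases hk : k ≤ l.length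
    · rw [if_pos hk, if_pos (by simpa using hk)]; simp; omega
    · rw [if_neg hk, if_neg (by simpa using hk)]; simp; omega

/-- **Reading `k ≤ |l|` items of a code.** [folklore] -/
theorem obRun_encList_of_le {k : ℕ} {l : List (List Bool)} (hk : k ≤ l.length) :
    obRun k (encList l) = (encList (l.drop k), (l.take k).map (fun it => decide (it = [true])), k, false) := by
  rw [obRun, obStep_iterate_encList, if_pos hk]; simp

/-- **Reading more items than a code holds.** [folklore] -/
theorem obRun_encList_of_lt {k : ℕ} {l : List (List Bool)} (hk : l.length < k) :
    obRun k (encList l) = ([], l.map (fun it => decide (it = [true])), l.length, true) := by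
  rw [obRun, obStep_iterate_encList, if_neg (by omega)]; simp

/-- Sizes along the reading: the unread string shrinks by at least two symbols per item.
[folklore] -/
theorem size_obStep (s : ObState) :
    (obStep s).1.length + 2 * (obStep s).2.2.1 ≤ s.1.length + 2 * s.2.2.1 ∧ (obStep s).2.1.length ≤ s.2.1.length + 1 := by
  unfold obStep
  split_ifs with h1 h2
  · constructor <;> omega
  · obtain ⟨u, v, huv⟩ := (wellPaired_iff s.1).1 h2
    simp [huv, boolUnpair_boolPair, length_boolPair]; omega
  · simp

/-- Sizes after `k` steps. [folklore] -/
theorem size_obRun (a : List Bool) : ∀ k : ℕ,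
    (obRun k a).1.length + 2 * (obRun k a).2.2.1 ≤ a.length ∧ (obRun k a).2.1.length ≤ k
  | 0 => by simp [obRun]
  | k + 1 => by
    obtain ⟨h1, h2⟩ := size_obRun a k
    obtain ⟨h3, h4⟩ := size_obStep (obRun k a)
    have e : obRun (k + 1) a = obStep (obRun k a) := Function.iterate_succ_apply' obStep k _
    rw [e]
    exact ⟨h3.trans h1, by omega⟩

/-! ### The value of the brick -/

/-- The output of the reader on width `u` and list `a`: `⟨[ok], ⟨payload, rest⟩⟩`. [folklore] -/
def takeItemsVal (u a : List Bool) : List Bool :=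
  let s := obRun u.length a
  boolPair [!s.2.2.2] (boolPair (if s.2.2.2 then encodeNat s.2.2.1 else norm s.2.1) s.1)

/-- `takeItemsFn ⟨u, a⟩`. [folklore] -/
def takeItemsFn (w : List Bool) : List Bool := takeItemsVal (boolUnpair w).1 (boolUnpair w).2

/-- **The reader on a long enough code**: `|u|` bits and the rest. [folklore] -/
theorem takeItemsFn_encList_of_le {u : List Bool} {l : List (List Bool)} (h : u.length ≤ l.length) :
    takeItemsFn (boolPair u (encList l)) =
      boolPair [true] (boolPair (norm ((l.take u.length).map fun it => decide (it = [true]))) (encList (l.drop u.length))) := by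
  simp [takeItemsFn, takeItemsVal, obRun_encList_of_le h]

/-- **The reader on a short code**: failure and the number of items. [folklore] -/
theorem takeItemsFn_encList_of_lt {u : List Bool} {l : List (List Bool)} (h : l.length < u.length) :
    takeItemsFn (boolPair u (encList l)) = boolPair [false] (boolPair (encodeNat l.length) []) := by
  simp [takeItemsFn, takeItemsVal, obRun_encList_of_lt h]

/-! ### The program -/

/-- Outer registers of the reader: unread string, bits (reversed), count (binary), latch, the
pair decoder's scratch, the emitter's scratch, the increment's scratch. [folklore] -/
inductive OI
  | cur | rb | cn | st | A | T | M | P | s1 | tb1 | tb2 | tb3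
  deriving DecidableEq, Fintype, Repr

/-- The register file of a reader state. [folklore] -/
def ofile (cur rb cn st : List Bool) : Regs OI := fun i =>
  match i with
  | .cur => cur
  | .rb => rb
  | .cn => cn
  | .st => st
  | _ => []

/-- Record the bit "the item reversed on `A` is `[true]`" on `rb`, emptying `A`. [folklore] -/
def testA : Com (OI ⊕ AReg) :=
  Com.pop (Sum.inl .A)
    (Com.pop (Sum.inl .A) (Com.push (Sum.inl .rb) false ;; Com.clear (Sum.inl .A))
      (Com.push (Sum.inl .rb) false ;; Com.clear (Sum.inl .A)) (Com.push (Sum.inl .rb) true))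
    (Com.push (Sum.inl .rb) false ;; Com.clear (Sum.inl .A))
    (Com.push (Sum.inl .rb) false)

/-- The reader's loop body: unless latched, split the unread string; on a well-formed pair keep
the rest, record the item's bit, count; otherwise latch and discard. [folklore] -/
def obBody : Com (OI ⊕ AReg) :=
  Com.ifFlag (Sum.inl .st) Com.skip
    (Com.unpairW (Sum.inl .cur) (Sum.inl .A) (Sum.inl .T) (Sum.inl .M) (Sum.inl .P) ;;
      Com.pop (Sum.inl .M)
        (Com.pour (Sum.inl .T) (Sum.inl .cur) ;; (testA ;; Com.incr (Sum.inl .cn) (Sum.inl .tb1) (Sum.inl .tb2) (Sum.inl .tb3)))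
        Com.skip
        (Com.push (Sum.inl .st) true ;; (Com.clear (Sum.inl .A) ;; Com.clear (Sum.inl .T))))

/-- A file with `A = v` on top of a reader file. [folklore] -/
def afile (cur rb cn st v : List Bool) : Regs OI := Function.update (ofile cur rb cn st) .A v

/-- **Effect of `testA`**: `rb` gains the bit `decide (vʳ = [true])`, `A` is emptied; cost
`≤ 2|v| + 6`. [folklore] -/
theorem runs_testA (cur rb cn st v bx : List Bool) :
    Com.Runs testA (Sum.elim (afile cur rb cn st v) (file bx [] [] [] [] [] [] []))
      (Sum.elim (ofile cur (decide (v.reverse = [true]) :: rb) cn st) (file bx [] [] [] [] [] [] [])) (2 * v.length + 6) := by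
  have hupd : ∀ (w : List Bool) (b : Bool), Function.update (Function.update (Sum.elim (afile cur rb cn st w) (file bx [] [] [] [] [] [] []))
      (Sum.inl OI.rb) (b :: rb)) (Sum.inl OI.A) ([] : List Bool) = Sum.elim (ofile cur (b :: rb) cn st) (file bx [] [] [] [] [] [] []) := by
    intro w b; funext i; rcases i with i | i
    · cases i <;> simp [afile, ofile]
    · cases i <;> simp
  have hpc : ∀ (w : List Bool), Com.Runs (Com.push (Sum.inl .rb) false ;; Com.clear (Sum.inl .A) : Com (OI ⊕ AReg))
      (Sum.elim (afile cur rb cn st w) (file bx [] [] [] [] [] [] []))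
      (Sum.elim (ofile cur (false :: rb) cn st) (file bx [] [] [] [] [] [] [])) (1 + (2 * w.length + 1)) := by
    intro w
    refine (Com.Runs.push' rfl).seq ((Com.runs_clear (Sum.inl OI.A : OI ⊕ AReg) _).of_eq ?_ ?_)
    · rw [← hupd w false]; rfl
    · simp [afile]
  have hA : ∀ w, (Sum.elim (afile cur rb cn st w) (file bx [] [] [] [] [] [] []) : Regs (OI ⊕ AReg)) (Sum.inl OI.A) = w := by
    intro w; simp [afile]
  have hpop : ∀ w w', Function.update (Sum.elim (afile cur rb cn st w) (file bx [] [] [] [] [] [] [])) (Sum.inl OI.A : OI ⊕ AReg) w' =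
      Sum.elim (afile cur rb cn st w') (file bx [] [] [] [] [] [] []) := by
    intro w w'; funext i; rcases i with i | i
    · cases i <;> simp [afile]
    · cases i <;> simp
  -- the recorded bit, case by case
  have hdec : ∀ w : List Bool, decide (w.reverse = [true]) = decide (w = [true]) := fun w => by
    by_cases h : w = [true]
    · subst h; simp
    · have h' : ¬ w.reverse = [true] := fun h' => h (by simpa using congrArg List.reverse h')
      simp [h, h']
  unfold testA
  rcases v with _ | ⟨b, v⟩
  · -- empty item
    have h : Com.Runs (Com.push (Sum.inl .rb) false : Com (OI ⊕ AReg)) (Sum.elim (afile cur rb cn st []) (file bx [] [] [] [] [] [] []))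
        (Sum.elim (ofile cur (false :: rb) cn st) (file bx [] [] [] [] [] [] [])) 1 := by
      refine Com.Runs.push' ?_
      funext i; rcases i with i | i
      · cases i <;> simp [afile, ofile]
      · cases i <;> simp
    refine (Com.Runs.pop_nil _ _ (hA []) h).of_eq rfl (by omega)
  · cases b
    · -- starts with `0`
      have e : decide ((false :: v).reverse = [true]) = false := by rw [hdec]; simp
      rw [e]
      exact (Com.Runs.pop_false _ _ (hA (false :: v)) (by rw [hpop]; exact hpc v)).of_eq rfl (by simp; omega)
    · -- starts with `1`
      rcases v with _ | ⟨b', v⟩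
      · have h : Com.Runs (Com.push (Sum.inl .rb) true : Com (OI ⊕ AReg)) (Sum.elim (afile cur rb cn st []) (file bx [] [] [] [] [] [] []))
            (Sum.elim (ofile cur (true :: rb) cn st) (file bx [] [] [] [] [] [] [])) 1 := by
          refine Com.Runs.push' ?_
          funext i; rcases i with i | i
          · cases i <;> simp [afile, ofile]
          · cases i <;> simp
        have h2 := Com.Runs.pop_nil (k := (Sum.inl OI.A : OI ⊕ AReg)) (Com.push (Sum.inl .rb) false ;; Com.clear (Sum.inl .A))
          (Com.push (Sum.inl .rb) false ;; Com.clear (Sum.inl .A)) (hA []) h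
        have e : decide (([true] : List Bool).reverse = [true]) = true := by simp
        rw [e]
        exact (Com.Runs.pop_true _ _ (hA [true]) (by rw [hpop]; exact h2)).of_eq rfl (by omega)
      · have hin : Com.Runs (Com.pop (Sum.inl .A) (Com.push (Sum.inl .rb) false ;; Com.clear (Sum.inl .A))
            (Com.push (Sum.inl .rb) false ;; Com.clear (Sum.inl .A)) (Com.push (Sum.inl .rb) true) : Com (OI ⊕ AReg))
            (Sum.elim (afile cur rb cn st (b' :: v)) (file bx [] [] [] [] [] [] []))
            (Sum.elim (ofile cur (false :: rb) cn st) (file bx [] [] [] [] [] [] [])) (1 + (2 * v.length + 1) + 2) := by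
          cases b'
          · exact Com.Runs.pop_false _ _ (hA (false :: v)) (by rw [hpop]; exact hpc v)
          · exact Com.Runs.pop_true _ _ (hA (true :: v)) (by rw [hpop]; exact hpc v)
        have e : decide ((true :: b' :: v).reverse = [true]) = false := by rw [hdec]; simp
        rw [e]
        exact (Com.Runs.pop_true _ _ (hA (true :: b' :: v)) (by rw [hpop]; exact hin)).of_eq rfl (by simp; omega)

/-- **One iteration of the reader's loop** realises `obStep` (with `rb` holding the bits
reversed and `cn` the count in binary), in `30 (|cur| + |encodeNat c|) + 60` steps. [folklore] -/
theorem runs_obBody (cur bits : List Bool) (c : ℕ) (st : Bool) (bx : List Bool) :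
    Com.Runs obBody (Sum.elim (ofile cur bits.reverse (encodeNat c) (flag st)) (file bx [] [] [] [] [] [] []))
      (Sum.elim (ofile (obStep (cur, bits, c, st)).1 (obStep (cur, bits, c, st)).2.1.reverse
        (encodeNat (obStep (cur, bits, c, st)).2.2.1) (flag (obStep (cur, bits, c, st)).2.2.2)) (file bx [] [] [] [] [] [] []))
      (30 * (cur.length + (encodeNat c).length) + 60) := by
  cases st
  · -- running
    have hd : [(Sum.inl OI.cur : OI ⊕ AReg), Sum.inl .A, Sum.inl .T, Sum.inl .M, Sum.inl .P].Nodup := by simp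
    have h1 := Com.runs_unpairW hd (Sum.elim (ofile cur bits.reverse (encodeNat c) (flag false)) (file bx [] [] [] [] [] [] [])) rfl rfl
    simp only [Sum.elim_inl] at h1
    set it := (boolUnpair cur).1 with hit
    set rest := (boolUnpair cur).2 with hrest
    have hlen : 2 * it.length + rest.length ≤ cur.length := by rw [hit, hrest]; exact length_boolUnpair_parts_le cur
    set R1 : Regs (OI ⊕ AReg) := Sum.elim (fun i => match i with
      | .A => it.reverse | .T => rest.reverse | .M => flag (wellPaired cur) | .rb => bits.reverse | .cn => encodeNat c | _ => [])
      (file bx [] [] [] [] [] [] []) with hR1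
    have e1 : Function.update (Function.update (Function.update (Function.update (Function.update
        (Sum.elim (ofile cur bits.reverse (encodeNat c) (flag false)) (file bx [] [] [] [] [] [] [])) (Sum.inl OI.cur) []) (Sum.inl OI.A)
        (it.reverse ++ (ofile cur bits.reverse (encodeNat c) (flag false)) OI.A)) (Sum.inl OI.T)
        (rest.reverse ++ (ofile cur bits.reverse (encodeNat c) (flag false)) OI.T))
        (Sum.inl OI.M) (flag (wellPaired cur))) (Sum.inl OI.P) [] = R1 := by
      rw [hR1]; funext i; rcases i with i | i
      · cases i <;> simp [ofile]
      · cases i <;> simp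
    rw [show (ofile cur bits.reverse (encodeNat c) (flag false)) OI.cur = cur from rfl, e1] at h1
    by_cases hw : wellPaired cur = true
    · -- an item
      have hstep : obStep (cur, bits, c, false) = (rest, bits ++ [decide (it = [true])], c + 1, false) := by
        simp [obStep, hw, hit, hrest]
      rw [hstep]
      have hM : R1 (Sum.inl OI.M) = true :: [] := by simp [hR1, hw]
      set R2 : Regs (OI ⊕ AReg) := Sum.elim (fun i => match i with
        | .A => it.reverse | .T => rest.reverse | .rb => bits.reverse | .cn => encodeNat c | _ => []) (file bx [] [] [] [] [] [] []) with hR2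
      have hw2 : Function.update R1 (Sum.inl OI.M) [] = R2 := by
        rw [hR1, hR2]; funext i; rcases i with i | i
        · cases i <;> simp
        · cases i <;> simp
      -- pour T cur
      have h3 : Com.Runs (Com.pour (Sum.inl .T) (Sum.inl .cur) : Com (OI ⊕ AReg)) R2
          (Sum.elim (afile rest bits.reverse (encodeNat c) (flag false) it.reverse) (file bx [] [] [] [] [] [] [])) (3 * rest.length + 1) := by
        refine (Com.runs_pour (a := (Sum.inl OI.T : OI ⊕ AReg)) (b := Sum.inl OI.cur) (by simp) R2).of_eq ?_ (by simp [hR2])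
        rw [hR2]; funext i; rcases i with i | i
        · cases i <;> simp [afile, ofile]
        · cases i <;> simp
      -- the bit
      have h4 := runs_testA rest bits.reverse (encodeNat c) (flag false) it.reverse bx
      rw [List.reverse_reverse, List.length_reverse] at h4
      -- the count
      have h5 : Com.Runs (Com.incr (Sum.inl .cn) (Sum.inl .tb1) (Sum.inl .tb2) (Sum.inl .tb3) : Com (OI ⊕ AReg))
          (Sum.elim (ofile rest (decide (it = [true]) :: bits.reverse) (encodeNat c) (flag false)) (file bx [] [] [] [] [] [] []))
          (Sum.elim (ofile rest (decide (it = [true]) :: bits.reverse) (encodeNat (c + 1)) (flag false)) (file bx [] [] [] [] [] [] []))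
          (9 * (encodeNat c).length + 14) := by
        refine (Com.runs_incr (B := (Sum.inl OI.cn : OI ⊕ AReg)) (t := Sum.inl OI.tb1) (t2 := Sum.inl OI.tb2) (fl := Sum.inl OI.tb3)
          (by simp) (by simp) (by simp) (by simp) (by simp) (by simp) _ rfl rfl rfl).of_eq ?_ (by simp [ofile])
        funext i; rcases i with i | i
        · cases i <;> simp [ofile, encodeNat_succ_eq_incRes]
        · cases i <;> simp
      have hbr : Com.Runs (Com.pop (Sum.inl .M)
            (Com.pour (Sum.inl .T) (Sum.inl .cur) ;; (testA ;; Com.incr (Sum.inl .cn) (Sum.inl .tb1) (Sum.inl .tb2) (Sum.inl .tb3)))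
            Com.skip (Com.push (Sum.inl .st) true ;; (Com.clear (Sum.inl .A) ;; Com.clear (Sum.inl .T))) : Com (OI ⊕ AReg)) R1
          (Sum.elim (ofile rest (decide (it = [true]) :: bits.reverse) (encodeNat (c + 1)) (flag false)) (file bx [] [] [] [] [] [] []))
          (3 * rest.length + 1 + (2 * it.length + 6 + (9 * (encodeNat c).length + 14)) + 2) :=
        Com.Runs.pop_true _ _ hM (by rw [hw2]; exact h3.seq (h4.seq h5))
      have e2 : (bits ++ [decide (it = [true])]).reverse = decide (it = [true]) :: bits.reverse := by simp
      rw [e2]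
      exact (Com.runs_ifFlag_false Com.skip (by rfl) (h1.seq hbr)).mono (by omega)
    · -- latch
      rw [Bool.not_eq_true] at hw
      have hstep : obStep (cur, bits, c, false) = ([], bits, c, true) := by simp [obStep, hw]
      rw [hstep]
      have hM : R1 (Sum.inl OI.M) = [] := by simp [hR1, hw]
      set R2 : Regs (OI ⊕ AReg) := Sum.elim (fun i => match i with
        | .A => it.reverse | .T => rest.reverse | .rb => bits.reverse | .cn => encodeNat c | .st => [true] | _ => [])
        (file bx [] [] [] [] [] [] []) with hR2
      have h2 : Com.Runs (Com.push (Sum.inl .st) true : Com (OI ⊕ AReg)) R1 R2 1 := by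
        refine Com.Runs.push' ?_
        rw [hR1, hR2]; funext i; rcases i with i | i
        · cases i <;> simp [hw]
        · cases i <;> simp
      set R3 : Regs (OI ⊕ AReg) := Sum.elim (fun i => match i with
        | .T => rest.reverse | .rb => bits.reverse | .cn => encodeNat c | .st => [true] | _ => []) (file bx [] [] [] [] [] [] []) with hR3
      have h3 : Com.Runs (Com.clear (Sum.inl .A) : Com (OI ⊕ AReg)) R2 R3 (2 * it.length + 1) := by
        refine (Com.runs_clear (Sum.inl OI.A : OI ⊕ AReg) R2).of_eq ?_ (by simp [hR2])
        rw [hR2, hR3]; funext i; rcases i with i | i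
        · cases i <;> simp
        · cases i <;> simp
      have h4 : Com.Runs (Com.clear (Sum.inl .T) : Com (OI ⊕ AReg)) R3
          (Sum.elim (ofile [] bits.reverse (encodeNat c) (flag true)) (file bx [] [] [] [] [] [] [])) (2 * rest.length + 1) := by
        refine (Com.runs_clear (Sum.inl OI.T : OI ⊕ AReg) R3).of_eq ?_ (by simp [hR3])
        rw [hR3]; funext i; rcases i with i | i
        · cases i <;> simp [ofile]
        · cases i <;> simp
      have hbr : Com.Runs (Com.pop (Sum.inl .M)
            (Com.pour (Sum.inl .T) (Sum.inl .cur) ;; (testA ;; Com.incr (Sum.inl .cn) (Sum.inl .tb1) (Sum.inl .tb2) (Sum.inl .tb3)))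
            Com.skip (Com.push (Sum.inl .st) true ;; (Com.clear (Sum.inl .A) ;; Com.clear (Sum.inl .T))) : Com (OI ⊕ AReg)) R1
          (Sum.elim (ofile [] bits.reverse (encodeNat c) (flag true)) (file bx [] [] [] [] [] [] [])) (1 + (2 * it.length + 1 + (2 * rest.length + 1)) + 2) :=
        Com.Runs.pop_nil _ _ hM (h2.seq (h3.seq h4))
      exact (Com.runs_ifFlag_false Com.skip (by rfl) (h1.seq hbr)).mono (by omega)
  · -- latched
    have hstep : obStep (cur, bits, c, true) = (cur, bits, c, true) := by simp [obStep]
    rw [hstep]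
    have h : Com.Runs obBody (Sum.elim (ofile cur bits.reverse (encodeNat c) (flag true)) (file bx [] [] [] [] [] [] []))
        (Sum.elim (ofile cur bits.reverse (encodeNat c) (flag true)) (file bx [] [] [] [] [] [] [])) (0 + 3) := by
      unfold obBody
      exact Com.runs_ifFlag (F := (Sum.inl OI.st : OI ⊕ AReg)) (b := true)
        (R := Sum.elim (ofile cur bits.reverse (encodeNat c) (flag true)) (file bx [] [] [] [] [] [] [])) rfl (fun _ => Com.Runs.skip _)
        (fun h => absurd h (by decide))
    exact h.mono (by omega)

/-- **The reader's loop**: `|u|` iterations from `(a, [], 0, false)` reach `obRun |u| a`, within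
`|u| (60 |a| + 62) + 1` steps. [folklore] -/
theorem runs_obLoop (u a : List Bool) :
    Com.Runs (Com.loop (Sum.inr .x) obBody obBody : Com (OI ⊕ AReg)) (Sum.elim (ofile a [] [] []) (file u [] [] [] [] [] [] []))
      (Sum.elim (ofile (obRun u.length a).1 (obRun u.length a).2.1.reverse (encodeNat (obRun u.length a).2.2.1)
        (flag (obRun u.length a).2.2.2)) (file [] [] [] [] [] [] [] [])) ((30 * (a.length + a.length) + 60 + 2) * u.length + 1) := by
  let Φ : ℕ → Regs (OI ⊕ AReg) := fun i => Sum.elim (ofile (obRun i a).1 (obRun i a).2.1.reverse (encodeNat (obRun i a).2.2.1)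
    (flag (obRun i a).2.2.2)) (file [] [] [] [] [] [] [] [])
  have hΦ : ∀ i, Φ i (Sum.inr .x) = [] := fun i => rfl
  have hupd : ∀ (i : ℕ) (w : List Bool), Function.update (Φ i) (Sum.inr .x) w =
      Sum.elim (ofile (obRun i a).1 (obRun i a).2.1.reverse (encodeNat (obRun i a).2.2.1) (flag (obRun i a).2.2.2)) (file w [] [] [] [] [] [] []) := by
    intro i w; funext j; rcases j with j | j
    · cases j <;> simp [Φ]
    · cases j <;> simp [Φ]
  have hbody : ∀ i, 0 ≤ i → i < 0 + u.length → ∀ w : List Bool,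
      Com.Runs obBody (Function.update (Φ i) (Sum.inr .x) w) (Function.update (Φ (i + 1)) (Sum.inr .x) w) (30 * (a.length + a.length) + 60) := by
    intro i _ _ w
    rw [hupd, hupd]
    have h := runs_obBody (obRun i a).1 (obRun i a).2.1 (obRun i a).2.2.1 (obRun i a).2.2.2 w
    have e : obRun (i + 1) a = obStep (obRun i a) := Function.iterate_succ_apply' obStep i _
    rw [e]
    refine h.mono ?_
    obtain ⟨hs, -⟩ := size_obRun a i
    have hc := length_encodeNat_le (obRun i a).2.2.1
    have : (obRun i a).1.length + (encodeNat (obRun i a).2.2.1).length ≤ a.length + a.length := by omega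
    omega
  have h := Com.runs_indexLoop (c := (Sum.inr AReg.x : OI ⊕ AReg)) (body := obBody) Φ (30 * (a.length + a.length) + 60) hΦ u 0 hbody
  rw [Nat.zero_add, hupd] at h
  have e0 : Sum.elim (ofile (obRun 0 a).1 (obRun 0 a).2.1.reverse (encodeNat (obRun 0 a).2.2.1) (flag (obRun 0 a).2.2.2)) (file u [] [] [] [] [] [] []) =
      (Sum.elim (ofile a [] [] []) (file u [] [] [] [] [] [] []) : Regs (OI ⊕ AReg)) := by
    funext i; rcases i with i | i
    · cases i <;> rfl
    · cases i <;> rfl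
  rw [e0] at h
  exact h

/-- Emit the reversed payload on `s1` doubled onto `x`. [folklore] -/
def odbl (b : Bool) : Com (OI ⊕ AReg) := Com.push (Sum.inr .x) b ;; Com.push (Sum.inr .x) b

/-- A file with `s1 = v` on top of a reader file (used by the output stage). [folklore] -/
def sfile (cur rb cn st v : List Bool) : Regs OI := Function.update (ofile cur rb cn st) .s1 v

/-- **The doubling loop of the output stage**: `x := dbl (vʳ) ++ x`, `s1` emptied. [folklore] -/
theorem runs_odblLoop (cur rb cn st : List Bool) (v : List Bool) : ∀ (xs : List Bool),
    Com.Runs (Com.loop (Sum.inl OI.s1) (odbl true) (odbl false) : Com (OI ⊕ AReg))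
      (Sum.elim (sfile cur rb cn st v) (file xs [] [] [] [] [] [] []))
      (Sum.elim (ofile cur rb cn st) (file ((v.reverse.flatMap fun b => [b, b]) ++ xs) [] [] [] [] [] [] [])) (4 * v.length + 1) := by
  induction v with
  | nil =>
    intro xs
    refine (Com.Runs.loop_nil _ _ (by simp [sfile])).of_eq ?_ (by simp)
    funext i; rcases i with i | i
    · cases i <;> simp [sfile, ofile]
    · cases i <;> simp
  | cons b v ih =>
    intro xs
    have hk : (Sum.elim (sfile cur rb cn st (b :: v)) (file xs [] [] [] [] [] [] []) : Regs (OI ⊕ AReg)) (Sum.inl OI.s1) = b :: v := by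
      simp [sfile]
    have hw : Function.update (Sum.elim (sfile cur rb cn st (b :: v)) (file xs [] [] [] [] [] [] [])) (Sum.inl OI.s1 : OI ⊕ AReg) v =
        Sum.elim (sfile cur rb cn st v) (file xs [] [] [] [] [] [] []) := by
      funext i; rcases i with i | i
      · cases i <;> simp [sfile]
      · cases i <;> simp
    have hbody : ∀ d : Bool, Com.Runs (odbl d) (Function.update (Sum.elim (sfile cur rb cn st (b :: v)) (file xs [] [] [] [] [] [] [])) (Sum.inl OI.s1 : OI ⊕ AReg) v)
        (Sum.elim (sfile cur rb cn st v) (file (d :: d :: xs) [] [] [] [] [] [] [])) 2 := fun d => by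
      rw [hw]
      exact (Com.Runs.push' (R' := Sum.elim (sfile cur rb cn st v) (file (d :: xs) [] [] [] [] [] [] []))
        (by funext i; rcases i with i | i <;> cases i <;> rfl)).seq (Com.Runs.push' (by funext i; rcases i with i | i <;> cases i <;> rfl))
    have e : ((b :: v).reverse.flatMap fun b => [b, b]) ++ xs = (v.reverse.flatMap fun b => [b, b]) ++ (b :: b :: xs) := by simp
    rw [e]
    cases b
    · exact (Com.Runs.loop_false hk (hbody false) (ih _)).of_eq rfl (by simp; omega)
    · exact (Com.Runs.loop_true hk (hbody true) (ih _)).of_eq rfl (by simp; omega)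

/-- The output stage: payload on `x` (the count if latched, the normalised bits otherwise),
then assemble `⟨[ok], ⟨payload, unread⟩⟩` on `x`. [folklore] -/
def obOut : Com (OI ⊕ AReg) :=
  Com.ifFlag (Sum.inl .st)
    (Com.clear (Sum.inl .rb) ;; Com.move (Sum.inl .cn) (Sum.inr .x) (Sum.inl .A))
    (Com.pour (Sum.inl .rb) (Sum.inr .x) ;; Com.bk Com.normalize) ;;
  (Com.pour (Sum.inr .x) (Sum.inl .s1) ;;
  (Com.move (Sum.inl .cur) (Sum.inr .x) (Sum.inl .A) ;;
  ((Com.push (Sum.inr .x) true ;; Com.push (Sum.inr .x) false) ;;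
  (Com.loop (Sum.inl .s1) (odbl true) (odbl false) ;;
  ((Com.push (Sum.inr .x) true ;; Com.push (Sum.inr .x) false) ;;
  Com.ifFlag (Sum.inl .st) (Com.push (Sum.inr .x) false ;; Com.push (Sum.inr .x) false)
    (Com.push (Sum.inr .x) true ;; Com.push (Sum.inr .x) true))))))

/-- **Effect of the output stage** from a reader file with `x` empty: the value
`boolPair [!st] (boolPair payload cur)` on `x`, within `20 (|cur| + |rb| + |cn|) + 40` steps.
[folklore] -/
theorem runs_obOut (cur rb cn : List Bool) (st : Bool) :
    ∃ T' : Regs OI, Com.Runs obOut (Sum.elim (ofile cur rb cn (flag st)) (file [] [] [] [] [] [] [] []))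
      (Sum.elim T' (file (boolPair [!st] (boolPair (if st then cn else norm rb.reverse) cur)) [] [] [] [] [] [] []))
      (20 * (cur.length + rb.length + cn.length) + 40) := by
  set pl := (if st then cn else norm rb.reverse) with hpl
  have hpll : pl.length ≤ rb.length + cn.length := by
    rw [hpl]; split_ifs
    · omega
    · have := length_norm_le rb.reverse; simp at this; omega
  -- stage 1: payload on `x`, `rb`/`cn` consumed accordingly
  set T1 : Regs OI := (if st then ofile cur [] [] (flag st) else ofile cur [] cn (flag st)) with hT1
  have h1 : Com.Runs (Com.ifFlag (Sum.inl .st)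
        (Com.clear (Sum.inl .rb) ;; Com.move (Sum.inl .cn) (Sum.inr .x) (Sum.inl .A))
        (Com.pour (Sum.inl .rb) (Sum.inr .x) ;; Com.bk Com.normalize) : Com (OI ⊕ AReg))
      (Sum.elim (ofile cur rb cn (flag st)) (file [] [] [] [] [] [] [] [])) (Sum.elim T1 (file pl [] [] [] [] [] [] []))
      (12 * (rb.length + cn.length) + 6 + 3) := by
    refine Com.runs_ifFlag (b := st) rfl (fun hst => ?_) (fun hst => ?_)
    · subst hst
      have ha : Com.Runs (Com.clear (Sum.inl .rb) : Com (OI ⊕ AReg)) (Sum.elim (ofile cur rb cn (flag true)) (file [] [] [] [] [] [] [] []))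
          (Sum.elim (ofile cur [] cn (flag true)) (file [] [] [] [] [] [] [] [])) (2 * rb.length + 1) := by
        refine (Com.runs_clear (Sum.inl OI.rb : OI ⊕ AReg) _).of_eq ?_ (by simp [ofile])
        funext i; rcases i with i | i
        · cases i <;> simp [ofile]
        · cases i <;> simp
      have hb : Com.Runs (Com.move (Sum.inl .cn) (Sum.inr .x) (Sum.inl .A) : Com (OI ⊕ AReg)) (Sum.elim (ofile cur [] cn (flag true)) (file [] [] [] [] [] [] [] []))
          (Sum.elim (ofile cur [] [] (flag true)) (file cn [] [] [] [] [] [] [])) (6 * cn.length + 2) := by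
        refine (Com.runs_move (a := (Sum.inl OI.cn : OI ⊕ AReg)) (b := Sum.inr AReg.x) (t := Sum.inl OI.A) (by simp) (by simp) (by simp) _
          rfl).of_eq ?_ (by simp [ofile])
        funext i; rcases i with i | i
        · cases i <;> simp [ofile]
        · cases i <;> simp [ofile]
      simp only [hT1, hpl, if_true]
      exact (ha.seq hb).mono (by omega)
    · subst hst
      have ha : Com.Runs (Com.pour (Sum.inl .rb) (Sum.inr .x) : Com (OI ⊕ AReg)) (Sum.elim (ofile cur rb cn (flag false)) (file [] [] [] [] [] [] [] []))
          (Sum.elim (ofile cur [] cn (flag false)) (file rb.reverse [] [] [] [] [] [] [])) (3 * rb.length + 1) := by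
        refine (Com.runs_pour (a := (Sum.inl OI.rb : OI ⊕ AReg)) (b := Sum.inr AReg.x) (by simp) _).of_eq ?_ (by simp [ofile])
        funext i; rcases i with i | i
        · cases i <;> simp [ofile]
        · cases i <;> simp [ofile]
      have hb : Com.Runs (Com.bk Com.normalize : Com (OI ⊕ AReg)) (Sum.elim (ofile cur [] cn (flag false)) (file rb.reverse [] [] [] [] [] [] []))
          (Sum.elim (ofile cur [] cn (flag false)) (file (norm rb.reverse) [] [] [] [] [] [] [])) (9 * rb.length + 5) :=
        ((Com.runs_normalize rb.reverse [] [] [] [] []).inr _).of_eq rfl (by simp)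
      simp only [hT1, hpl]
      exact (ha.seq hb).mono (by omega)
  have hT1st : T1 OI.st = flag st := by rw [hT1]; split_ifs <;> rfl
  have hT1cur : T1 OI.cur = cur := by rw [hT1]; split_ifs <;> rfl
  have hT1s1 : T1 OI.s1 = [] := by rw [hT1]; split_ifs <;> rfl
  have hT1A : T1 OI.A = [] := by rw [hT1]; split_ifs <;> rfl
  -- stage 2: payload reversed onto `s1`
  set T2 := Function.update T1 .s1 pl.reverse with hT2
  have h2 : Com.Runs (Com.pour (Sum.inr .x) (Sum.inl .s1) : Com (OI ⊕ AReg)) (Sum.elim T1 (file pl [] [] [] [] [] [] []))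
      (Sum.elim T2 (file [] [] [] [] [] [] [] [])) (3 * pl.length + 1) :=
    (Com.runs_pour (a := (Sum.inr AReg.x : OI ⊕ AReg)) (b := Sum.inl OI.s1) (by simp) _).of_eq
      (by rw [hT2]; simp [hT1s1]) (by simp)
  -- stage 3: the unread string onto `x`
  set T3 := Function.update T2 .cur [] with hT3
  have h3 : Com.Runs (Com.move (Sum.inl .cur) (Sum.inr .x) (Sum.inl .A) : Com (OI ⊕ AReg)) (Sum.elim T2 (file [] [] [] [] [] [] [] []))
      (Sum.elim T3 (file cur [] [] [] [] [] [] [])) (6 * cur.length + 2) := by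
    have hcur2 : T2 OI.cur = cur := by rw [hT2, Function.update_of_ne (by decide), hT1cur]
    refine (Com.runs_move (a := (Sum.inl OI.cur : OI ⊕ AReg)) (b := Sum.inr AReg.x) (t := Sum.inl OI.A) (by simp) (by simp) (by simp) _
      (by simp [hT2, hT1A])).of_eq ?_ (by simp [hcur2])
    rw [hT3]; simp [hcur2]
  -- stage 4: separator, doubled payload, separator, the ok bit
  have h4 : Com.Runs (Com.push (Sum.inr .x) true ;; Com.push (Sum.inr .x) false : Com (OI ⊕ AReg)) (Sum.elim T3 (file cur [] [] [] [] [] [] []))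
      (Sum.elim T3 (file (false :: true :: cur) [] [] [] [] [] [] [])) 2 :=
    (Com.Runs.push' (R' := Sum.elim T3 (file (true :: cur) [] [] [] [] [] [] [])) (by simp)).seq (Com.Runs.push' (by simp))
  have hT3eq : T3 = sfile [] [] (if st then [] else cn) (flag st) pl.reverse := by
    rw [hT3, hT2, hT1]
    funext i; cases i <;> split_ifs <;> simp [sfile, ofile]
  have h5 := runs_odblLoop [] [] (if st then [] else cn) (flag st) pl.reverse (false :: true :: cur)
  rw [← hT3eq, List.reverse_reverse, List.length_reverse] at h5
  set T5 : Regs OI := ofile [] [] (if st then [] else cn) (flag st) with hT5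
  have h6 : Com.Runs (Com.push (Sum.inr .x) true ;; Com.push (Sum.inr .x) false : Com (OI ⊕ AReg))
      (Sum.elim T5 (file ((pl.flatMap fun b => [b, b]) ++ false :: true :: cur) [] [] [] [] [] [] []))
      (Sum.elim T5 (file (false :: true :: ((pl.flatMap fun b => [b, b]) ++ false :: true :: cur)) [] [] [] [] [] [] [])) 2 :=
    (Com.Runs.push' (R' := Sum.elim T5 (file (true :: ((pl.flatMap fun b => [b, b]) ++ false :: true :: cur)) [] [] [] [] [] [] []))
      (by simp)).seq (Com.Runs.push' (by simp))
  have h7 : Com.Runs (Com.ifFlag (Sum.inl .st) (Com.push (Sum.inr .x) false ;; Com.push (Sum.inr .x) false)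
        (Com.push (Sum.inr .x) true ;; Com.push (Sum.inr .x) true) : Com (OI ⊕ AReg))
      (Sum.elim T5 (file (false :: true :: ((pl.flatMap fun b => [b, b]) ++ false :: true :: cur)) [] [] [] [] [] [] []))
      (Sum.elim T5 (file ((!st) :: (!st) :: false :: true :: ((pl.flatMap fun b => [b, b]) ++ false :: true :: cur)) [] [] [] [] [] [] [])) (2 + 3) := by
    refine Com.runs_ifFlag (b := st) (by simp [hT5, ofile]) (fun hst => ?_) (fun hst => ?_)
    · subst hst
      exact (Com.Runs.push' (R' := Sum.elim T5 (file (false :: false :: true :: ((pl.flatMap fun b => [b, b]) ++ false :: true :: cur)) [] [] [] [] [] [] []))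
        (by simp)).seq (Com.Runs.push' (by simp))
    · subst hst
      exact (Com.Runs.push' (R' := Sum.elim T5 (file (true :: false :: true :: ((pl.flatMap fun b => [b, b]) ++ false :: true :: cur)) [] [] [] [] [] [] []))
        (by simp)).seq (Com.Runs.push' (by simp))
  refine ⟨T5, (h1.seq (h2.seq (h3.seq (h4.seq (h5.seq (h6.seq h7)))))).of_eq ?_ ?_⟩
  · congr 1; simp [boolPair]
  · omega

/-- The reader brick's routine: the loop over the width on `x`, then the output stage.
[folklore] -/
def takeItemsC : Com (OI ⊕ AReg) := Com.loop (Sum.inr .x) obBody obBody ;; obOut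

/-- The start file of the reader brick. [folklore] -/
theorem init2_oi (u a : List Bool) :
    init2 (Sum.inr AReg.x : OI ⊕ AReg) (Sum.inl OI.cur) u a = Sum.elim (ofile a [] [] []) (file u [] [] [] [] [] [] []) := by
  funext i; rcases i with i | i
  · cases i <;> rfl
  · cases i <;> rfl

/-- **`takeItemsFn ∈ FP`.** [cite: AroraBarak2009, §1.3 (polynomial time is closed under subroutine calls)] -/
theorem takeItemsFn_mem_FP : takeItemsFn ∈ FP := by
  refine binOp_mem_FP takeItemsC (show (Sum.inr AReg.x : OI ⊕ AReg) ≠ Sum.inl OI.cur by simp) (Sum.inr AReg.x)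
    takeItemsVal (fun n => (120 * n + 62) * n + 1 + (60 * n + 40)) ((120 * Polynomial.X + 62) * Polynomial.X + 1 + (60 * Polynomial.X + 40))
    (fun n => by simp) (fun u a => ?_) (fun u a => ?_)
  · obtain ⟨hs, hb⟩ := size_obRun a u.length
    have hc := length_encodeNat_le (obRun u.length a).2.2.1
    have hn := length_norm_le (obRun u.length a).2.1
    unfold takeItemsVal
    simp only [length_boolPair, List.length_singleton]
    split_ifs
    · simp; nlinarith
    · simp; nlinarith
  · rw [init2_oi]
    have h1 := runs_obLoop u a
    set s := obRun u.length a with hsdef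
    obtain ⟨T', h2⟩ := runs_obOut s.1 s.2.1.reverse (encodeNat s.2.2.1) s.2.2.2
    rw [List.reverse_reverse, List.length_reverse] at h2
    obtain ⟨hs, hb⟩ := size_obRun a u.length
    have hc := length_encodeNat_le s.2.2.1
    rw [← hsdef] at hs hb
    refine ⟨_, (h1.seq h2).mono ?_, ?_⟩
    · have : (30 * (a.length + a.length) + 60 + 2) * u.length ≤ (120 * (u.length + a.length) + 62) * (u.length + a.length) :=
        Nat.mul_le_mul (by omega) (by omega)
      omega
    · simp [takeItemsVal, ← hsdef]

end Brick

end Literature.Computability.Complexity
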